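import Summits.KontsevichZagierPeriods.KontsevichZagierPeriods.Theorems.HurwitzMicroSectorsHurwitzSectorComplementStubTowerReductionSlab
import Summits.KontsevichZagierPeriods.KontsevichZagierPeriods.Theorems.HurwitzMicroSectorsHurwitzSectorComplementStubNfValue
import Summits.KontsevichZagierPeriods.KontsevichZagierPeriods.Theorems.HurwitzMicroSectorsHurwitzSectorComplementStubSymReductionKit
import Summits.KontsevichZagierPeriods.KontsevichZagierPeriods.Theorems.HurwitzMicroSectorsBoxIntegralZetaTwo
import Literature.Analysis.SpecialFunctions.InvSinSqPartialFractions

/-!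
# `HurwitzSectorComplement` (stmt-KontsevichZagierPeriods-14341, route HurwitzMicroSectors),
# line `chebyshev-level-deformation`: the golden twist

`GoldenTwistInstance` of the crux ideation (SketchIdeator2 §2; `box 2` unfolded): the `ℚ`-RATIONAL
three-dimensional representation `[(0,1)² × (0, sin²(π/5)), 25(1+t³)/(1−t⁵)]` (`t = xy`; the height
`sin²(π/5) = (5−√5)/8` is cut out over `ℚ` by `0 < z`, `8z < 5`, `(8z−5)² > 5`) and
`[(0,1)², 6/(1−xy)]` are KZ-equivalent. Both have value `π²`, by the Galois relation
`(5−√5)(ζ(2,⅕)+ζ(2,⅘)) = 8π²` — not a distribution relation, so the landed rational tower theorem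
(`symmetricTowerSector`) cannot reach this pair; the line's sector theorem `parityTowerSector`
(real-algebraic coefficients; parallel lead c1, here the hypothesis `hPTS`, verbatim) does, after
de-twisting the height into the coefficient (`towerReduction_slab`). The value computation uses the
landed symmetric pair integral (`NfValue.setIntegral_pair`), the partial fraction expansion of
`π²/sin²` (`Literature.Analysis.SpecialFunctions.hasSum_inv_sub_sq_add_inv_add_sq`) and
`cos(π/5) = (1+√5)/4` (Mathlib). Reference: M. Kontsevich, D. Zagier, *Periods* (2001), §1.2.
-/

noncomputable section

open Set MeasureTheory Polynomial
open scoped BigOperators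
open Literature.NumberTheory.Transcendental

namespace Summit.KontsevichZagierPeriods.Theorems.HurwitzMicroSectorsHurwitzSectorComplement

namespace GoldenTwist

/-- `sin²(π/5) = (5 − √5)/8`. [folklore] -/
theorem sin_sq_pi_div_five : Real.sin (Real.pi / 5) ^ 2 = (5 - Real.sqrt 5) / 8 := by
  rw [Real.sin_sq, Real.cos_pi_div_five]
  have h5 : Real.sqrt 5 ^ 2 = 5 := Real.sq_sqrt (by norm_num)
  linear_combination (-1 / 16 : ℝ) * h5

/-- `0 < sin²(π/5)`. [folklore] -/
theorem sin_sq_pi_div_five_pos : 0 < Real.sin (Real.pi / 5) ^ 2 := by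
  have h : 0 < Real.sin (Real.pi / 5) := Real.sin_pos_of_pos_of_lt_pi (by positivity)
    (by linarith [Real.pi_pos])
  positivity

/-- `(5 − √5)/8` is algebraic (a root of `16X² − 20X + 5`). [folklore] -/
theorem isAlgebraic_height : IsAlgebraic ℚ ((5 - Real.sqrt 5) / 8 : ℝ) := by
  refine ⟨16 * X ^ 2 - 20 * X + 5, ?_, ?_⟩
  · intro h
    have := congrArg (fun p : ℚ[X] => p.coeff 0) h
    simp at this
  · have h5 : Real.sqrt 5 ^ 2 = 5 := Real.sq_sqrt (by norm_num)
    simp only [map_add, map_sub, map_mul, map_pow, Polynomial.aeval_X, map_ofNat]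
    linear_combination (1 / 4 : ℝ) * h5

/-- The height condition, solved: for `0 < z`, `8z < 5 ∧ 5 < (8z−5)²` iff `z < (5−√5)/8`. [folklore] -/
theorem height_iff {z : ℝ} (_hz : 0 < z) :
    (8 * z < 5 ∧ 5 < (8 * z - 5) ^ 2) ↔ z < (5 - Real.sqrt 5) / 8 := by
  have hs0 : 0 ≤ Real.sqrt 5 := Real.sqrt_nonneg 5
  have hs5 : Real.sqrt 5 < 5 := by
    rw [show (5:ℝ) = Real.sqrt 25 by rw [show (25:ℝ) = 5 ^ 2 by norm_num, Real.sqrt_sq (by norm_num)]]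
    exact Real.sqrt_lt_sqrt (by norm_num) (by norm_num)
  constructor
  · rintro ⟨h8, hsq⟩
    have hpos : 0 < 5 - 8 * z := by linarith
    have : Real.sqrt 5 < 5 - 8 * z := by
      rw [Real.sqrt_lt' hpos]
      nlinarith
    linarith
  · intro h
    have h8 : 8 * z < 5 - Real.sqrt 5 := by linarith
    refine ⟨by linarith, ?_⟩
    have hlt : Real.sqrt 5 < 5 - 8 * z := by linarith
    have h5 : Real.sqrt 5 ^ 2 = 5 := Real.sq_sqrt (by norm_num)
    nlinarith

/-- **The level-5 weight-2 symmetric value**: `Σ_k (5k+1)⁻² + Σ_k (5k+4)⁻² = π²/(25 sin²(π/5))`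
(partial fractions of `π²/sin²` at `x = 1/5`). [cite: AhlforsCA1979, Ch. 5 §2.1 (9)] -/
theorem pair_value :
    (∑' k : ℕ, 1 / (((5 : ℕ) : ℝ) * k + (1 : ℕ)) ^ 2) +
        (-1 : ℝ) ^ 2 * (∑' k : ℕ, 1 / (((5 : ℕ) : ℝ) * k + (((5 : ℕ) : ℝ) - (1 : ℕ))) ^ 2)
      = Real.pi ^ 2 / (25 * Real.sin (Real.pi / 5) ^ 2) := by
  push_cast
  set x : ℝ := 1 / 5 with hx
  have hxn : ∀ n : ℤ, x ≠ n := by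
    intro n h
    have h5 : (5 : ℝ) * n = 1 := by rw [← h, hx]; norm_num
    have h5' : (5 : ℤ) * n = 1 := by exact_mod_cast h5
    omega
  have h := Literature.Analysis.SpecialFunctions.hasSum_inv_sub_sq_add_inv_add_sq hxn
  have hs1 : Summable fun n : ℕ => 1 / (x - (n + 1)) ^ 2 :=
    Summable.of_nonneg_of_le (fun n => by positivity) (fun n => le_add_of_nonneg_right
      (by positivity)) h.summable
  have hs2 : Summable fun n : ℕ => 1 / (x + (n + 1)) ^ 2 :=
    Summable.of_nonneg_of_le (fun n => by positivity) (fun n => le_add_of_nonneg_left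
      (by positivity)) h.summable
  have hsum := h.tsum_eq
  rw [hs1.tsum_add hs2] at hsum
  -- the two arithmetic progressions
  have hA : (∑' k : ℕ, 1 / ((5 : ℝ) * k + 1) ^ 2) = (1 / 25) * ∑' k : ℕ, 1 / (x + k) ^ 2 := by
    rw [← tsum_mul_left]
    refine tsum_congr fun k => ?_
    rw [hx]
    field_simp
    ring
  have hB : (∑' k : ℕ, 1 / ((5 : ℝ) * k + (5 - 1)) ^ 2) =
      (1 / 25) * ∑' n : ℕ, 1 / (x - (n + 1)) ^ 2 := by
    rw [← tsum_mul_left]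
    refine tsum_congr fun k => ?_
    have hk : (5 : ℝ) * k + 4 ≠ 0 := by positivity
    have e : x - ((k : ℝ) + 1) = -((5 * k + 4) / 5) := by rw [hx]; ring
    rw [e, neg_sq, div_pow]
    rw [show (5 : ℝ) - 1 = 4 by norm_num]
    field_simp
    norm_num
  have hs3 : Summable fun k : ℕ => 1 / (x + k) ^ 2 := by
    rw [← summable_nat_add_iff 1]
    refine hs2.congr fun n => ?_
    push_cast
    ring_nf
  have hsplit : (∑' k : ℕ, 1 / (x + k) ^ 2) = 1 / x ^ 2 + ∑' n : ℕ, 1 / (x + (n + 1)) ^ 2 := by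
    rw [hs3.tsum_eq_zero_add]
    push_cast
    simp only [add_zero]
  rw [hA, hB, hsplit, show ((-1 : ℝ)) ^ 2 = 1 by norm_num, one_mul]
  have hπx : Real.pi * x = Real.pi / 5 := by rw [hx]; ring
  rw [hπx] at hsum
  have hx2 : 1 / x ^ 2 = 25 := by rw [hx]; norm_num
  rw [hx2] at hsum ⊢
  rw [mul_comm (25 : ℝ), div_mul_eq_div_div]
  linarith [hsum]

end GoldenTwist

open GoldenTwist in
/-- **The golden twist** (`GoldenTwistInstance` of SketchIdeator2 §2, `box 2` unfolded), modulo the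
line's sector theorem `parityTowerSector` (hypothesis `hPTS`, verbatim): the rational representations
`[(0,1)² × (0, sin²(π/5)), 25(1+t³)/(1−t⁵)]` and `[(0,1)², 6/(1−xy)]` (both of value `π²`) are
KZ-equivalent. [cite: KontsevichZagier2001, §1.2 Conjecture 1] -/
theorem goldenTwistInstance_of_parityTowerSector : (∀ (w N w' N' : ℕ), 2 ≤ w → 1 ≤ N → 2 ≤ w' → 1 ≤ N' → ∀ (r : KZ.IntegralRep w) (r' : KZ.IntegralRep w'), (∃ (Q R : Polynomial ℝ), (∀ i, IsAlgebraic ℚ (Q.coeff i)) ∧ (∀ i, IsAlgebraic ℚ (R.coeff i)) ∧ R.natDegree < N ∧ (∀ i j : ℕ, i + j + 2 = N → R.coeff i = (-1 : ℝ) ^ w * R.coeff j) ∧ (Odd w → R.coeff (N - 1) = 0) ∧ r.domain = {x | ∀ i, x i ∈ Set.Ioo (0:ℝ) 1} ∧ Set.EqOn r.integrand (fun x => Polynomial.eval (∏ i, x i) Q + Polynomial.eval (∏ i, x i) R / (1 - (∏ i, x i) ^ N)) r.domain) → (∃ (Q R : Polynomial ℝ), (∀ i, IsAlgebraic ℚ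 (Q.coeff i)) ∧ (∀ i, IsAlgebraic ℚ (R.coeff i)) ∧ R.natDegree < N' ∧ (∀ i j : ℕ, i + j + 2 = N' → R.coeff i = (-1 : ℝ) ^ w' * R.coeff j) ∧ (Odd w' → R.coeff (N' - 1) = 0) ∧ r'.domain = {x | ∀ i, x i ∈ Set.Ioo (0:ℝ) 1} ∧ Set.EqOn r'.integrand (fun x => Polynomial.eval (∏ i, x i) Q + Polynomial.eval (∏ i, x i) R / (1 - (∏ i, x i) ^ N')) r'.domain) → r.value = r'.value → KZ.Equivalent r r') → ∀ (r : KZ.IntegralRep 3) (r' : KZ.IntegralRep 2), r.domain = {x | x 0 ∈ Set.Ioo (0:ℝ) 1 ∧ x 1 ∈ Set.Ioo (0:ℝ) 1 ∧ 0 < x 2 ∧ 8 * x 2 < 5 ∧ 5 < (8 * x 2 - 5) ^ 2} → Set.EqOn r.integrand (fun x => 25 * (1 + (x 0 * x 1) ^ 3) / (1 - (x 0 * x 1) ^ 5)) r.domain → r'.domain = {x | ∀ i, x i ∈ Set.Ioo (0:ℝ) 1} → Set.EqOn r'.integrand (fun x => 6 / (1 - x 0 * x 1)) r'.domain → KZ.Equivalent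 r r' := by
  intro hPTS r r' hrd hrf hr'd hr'f
  set s : ℝ := (5 - Real.sqrt 5) / 8 with hs
  have hs_alg : IsAlgebraic ℚ s := isAlgebraic_height
  have hs_pos : 0 < s := by rw [hs, ← sin_sq_pi_div_five]; exact sin_sq_pi_div_five_pos
  -- the rational level-5 kernel, through the landed sector family
  obtain ⟨σ, _K, hσd, hσi, -, -⟩ := SymReduction.symReduction_kit 2 5 (le_refl 2) (by norm_num)
  set K : (Fin 2 → ℝ) → ℝ := (σ (25 + 25 * X ^ 3)).integrand with hK
  have hKx : ∀ x : Fin 2 → ℝ, K x = 25 * (1 + (x 0 * x 1) ^ 3) / (1 - (x 0 * x 1) ^ 5) := by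
    intro x
    rw [hK, hσi, Fin.prod_univ_two]
    simp only [map_add, map_mul, map_pow, Polynomial.aeval_X, map_ofNat]
    ring
  have hKsa : IsSemialgebraicFunOn ℚ {x : Fin 2 → ℝ | ∀ i, x i ∈ Set.Ioo (0:ℝ) 1} K := by
    rw [hK, ← hσd (25 + 25 * X ^ 3)]; exact (σ _).isSemialgebraicFunOn_integrand
  have hKint : IntegrableOn K {x : Fin 2 → ℝ | ∀ i, x i ∈ Set.Ioo (0:ℝ) 1} := by
    rw [hK, ← hσd (25 + 25 * X ^ 3)]; exact (σ _).integrableOn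
  -- de-twist
  have hrd' : r.domain = {z | (∀ i : Fin 2, z (Fin.castSucc i) ∈ Set.Ioo (0:ℝ) 1) ∧
      z (Fin.last 2) ∈ Set.Ioo 0 s} := by
    rw [hrd]
    ext z
    constructor
    · rintro ⟨h0, h1, h2, h8, hsq⟩
      refine ⟨fun i => ?_, h2, (height_iff h2).mp ⟨h8, hsq⟩⟩
      fin_cases i
      · exact h0
      · exact h1
    · rintro ⟨hb, h2, hlt⟩
      exact ⟨hb 0, hb 1, h2, ((height_iff h2).mpr hlt).1, ((height_iff h2).mpr hlt).2⟩
  have hrf' : Set.EqOn r.integrand (fun z => K (fun i => z (Fin.castSucc i))) r.domain := by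
    intro z hz
    show r.integrand z = K (fun i => z (Fin.castSucc i))
    rw [hKx, hrf hz]
    rfl
  obtain ⟨r₀, hr₀d, hr₀f, hrr₀⟩ := towerReduction_slab 0 s K hs_alg hs_pos hKsa hKint r hrd' hrf'
  -- values: both `π²`
  have hbox : ∀ x : Fin 2 → ℝ, x ∈ {x : Fin 2 → ℝ | ∀ i, x i ∈ Set.Ioo (0:ℝ) 1} →
      0 < x 0 * x 1 ∧ x 0 * x 1 < 1 := by
    intro x hx
    refine ⟨mul_pos (hx 0).1 (hx 1).1, ?_⟩
    calc x 0 * x 1 < 1 * 1 := mul_lt_mul'' (hx 0).2 (hx 1).2 (hx 0).1.le (hx 1).1.le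
      _ = 1 := one_mul 1
  have hmeas : MeasurableSet {x : Fin 2 → ℝ | ∀ i, x i ∈ Set.Ioo (0:ℝ) 1} := Beukers.measurableSet_cube 2
  have hv₀ : r₀.value = Real.pi ^ 2 := by
    have e0 : ∫ x in {x : Fin 2 → ℝ | ∀ i, x i ∈ Set.Ioo (0:ℝ) 1}, r₀.integrand x =
        ∫ x in {x : Fin 2 → ℝ | ∀ i, x i ∈ Set.Ioo (0:ℝ) 1}, s * K x :=
      setIntegral_congr_fun hmeas fun x hx => hr₀f (by rw [hr₀d]; exact hx)
    have e1 : ∫ x in {x : Fin 2 → ℝ | ∀ i, x i ∈ Set.Ioo (0:ℝ) 1}, K x =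
        ∫ x in {x : Fin 2 → ℝ | ∀ i, x i ∈ Set.Ioo (0:ℝ) 1},
          25 * (((∏ i, x i) ^ (1 - 1) + (-1 : ℝ) ^ 2 * (∏ i, x i) ^ (5 - 1 - 1)) / (1 - (∏ i, x i) ^ 5)) := by
      refine setIntegral_congr_fun hmeas fun x _ => ?_
      rw [hKx, Fin.prod_univ_two]
      ring
    have hpair := NfValue.setIntegral_pair (w := 2) (L := 5) (a := 1) (le_refl 2) (le_refl 1) (by norm_num)
    rw [KZ.IntegralRep.value, hr₀d, e0, integral_const_mul, e1, integral_const_mul, hpair, pair_value, hs,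
      ← sin_sq_pi_div_five]
    have hsin1 : Real.sin (Real.pi / 5) ≠ 0 :=
      (Real.sin_pos_of_pos_of_lt_pi (by positivity) (by linarith [Real.pi_pos])).ne'
    field_simp
  have hv' : r'.value = Real.pi ^ 2 := by
    have hz2 := (Summit.KontsevichZagierPeriods.HurwitzMicroSectors.BoxIntegralZetaTwo.boxIntegralZetaTwo_proof).2
    have e : ∫ x in {x : Fin 2 → ℝ | ∀ i, x i ∈ Set.Ioo (0:ℝ) 1}, r'.integrand x =
        ∫ x in {x : Fin 2 → ℝ | ∀ i, x i ∈ Set.Ioo (0:ℝ) 1}, 6 * (1 / (1 - x 0 * x 1)) := by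
      refine setIntegral_congr_fun hmeas fun x hx => ?_
      have hx' : x ∈ r'.domain := by rw [hr'd]; exact hx
      rw [hr'f hx']
      show (6 : ℝ) / (1 - x 0 * x 1) = 6 * (1 / (1 - x 0 * x 1))
      ring
    rw [KZ.IntegralRep.value, hr'd, e, integral_const_mul, hz2]
    ring
  have hv : r₀.value = r'.value := by rw [hv₀, hv']
  have h25 : IsAlgebraic ℚ (25 * s) := by
    have := (isAlgebraic_algebraMap (R := ℚ) (A := ℝ) (25 : ℚ)).mul hs_alg
    simpa using this
  -- both de-twisted representations lie in the sector
  have hshape : ∃ (Q R : Polynomial ℝ), (∀ i, IsAlgebraic ℚ (Q.coeff i)) ∧ (∀ i, IsAlgebraic ℚ (R.coeff i)) ∧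
      R.natDegree < 5 ∧ (∀ i j : ℕ, i + j + 2 = 5 → R.coeff i = (-1 : ℝ) ^ 2 * R.coeff j) ∧
      (Odd 2 → R.coeff (5 - 1) = 0) ∧ r₀.domain = {x | ∀ i, x i ∈ Set.Ioo (0:ℝ) 1} ∧
      Set.EqOn r₀.integrand (fun x => Polynomial.eval (∏ i, x i) Q +
        Polynomial.eval (∏ i, x i) R / (1 - (∏ i, x i) ^ 5)) r₀.domain := by
    refine ⟨0, C (25 * s) + C (25 * s) * X ^ 3, fun i => by rw [Polynomial.coeff_zero]; exact isAlgebraic_zero, fun i => ?_, ?_, ?_, ?_, hr₀d, ?_⟩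
    · simp only [coeff_add, coeff_C, coeff_C_mul_X_pow]
      split_ifs with h1 h2 <;>
        first
          | (exfalso; omega)
          | (simp only [add_zero, zero_add]; first | exact h25 | exact isAlgebraic_zero)
    · have h3 : (C (25 * s) + C (25 * s) * X ^ 3 : ℝ[X]).natDegree ≤ 3 := by
        refine (natDegree_add_le _ _).trans (max_le ?_ ?_)
        · rw [natDegree_C]; exact Nat.zero_le _
        · exact (natDegree_C_mul_le _ _).trans (natDegree_X_pow 3).le
      omega
    · intro i j hij
      rw [show ((-1 : ℝ) ^ 2) = 1 by norm_num, one_mul]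
      simp only [coeff_add, coeff_C, coeff_C_mul_X_pow]
      have hc : (i = 0 ∧ j = 3) ∨ (i = 1 ∧ j = 2) ∨ (i = 2 ∧ j = 1) ∨ (i = 3 ∧ j = 0) := by omega
      rcases hc with ⟨rfl, rfl⟩ | ⟨rfl, rfl⟩ | ⟨rfl, rfl⟩ | ⟨rfl, rfl⟩ <;> simp
    · intro h; exact absurd h (by decide)
    · intro x hx
      show r₀.integrand x = eval (∏ i, x i) 0 + eval (∏ i, x i) (C (25 * s) + C (25 * s) * X ^ 3) /
        (1 - (∏ i, x i) ^ 5)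
      rw [hr₀f hx]
      show s * K x = _
      rw [hKx, Fin.prod_univ_two]
      rw [hr₀d] at hx
      obtain ⟨h0, h1⟩ := hbox x hx
      have hne : (1 : ℝ) - (x 0 * x 1) ^ 5 ≠ 0 := by
        have : (x 0 * x 1) ^ 5 < 1 := pow_lt_one₀ h0.le h1 (by norm_num)
        linarith
      simp only [eval_zero, eval_add, eval_mul, eval_C, eval_pow, eval_X, zero_add]
      field_simp
  have hshape' : ∃ (Q R : Polynomial ℝ), (∀ i, IsAlgebraic ℚ (Q.coeff i)) ∧ (∀ i, IsAlgebraic ℚ (R.coeff i)) ∧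
      R.natDegree < 1 ∧ (∀ i j : ℕ, i + j + 2 = 1 → R.coeff i = (-1 : ℝ) ^ 2 * R.coeff j) ∧
      (Odd 2 → R.coeff (1 - 1) = 0) ∧ r'.domain = {x | ∀ i, x i ∈ Set.Ioo (0:ℝ) 1} ∧
      Set.EqOn r'.integrand (fun x => Polynomial.eval (∏ i, x i) Q +
        Polynomial.eval (∏ i, x i) R / (1 - (∏ i, x i) ^ 1)) r'.domain := by
    refine ⟨0, C 6, fun i => by rw [Polynomial.coeff_zero]; exact isAlgebraic_zero, fun i => ?_, by simp, fun i j hij => by omega,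
      fun h => absurd h (by decide), hr'd, ?_⟩
    · rw [coeff_C]
      split_ifs
      · have := isAlgebraic_algebraMap (R := ℚ) (A := ℝ) (6 : ℚ)
        simpa using this
      · exact isAlgebraic_zero
    · intro x hx
      show r'.integrand x = eval (∏ i, x i) 0 + eval (∏ i, x i) (C 6) / (1 - (∏ i, x i) ^ 1)
      rw [hr'f hx, Fin.prod_univ_two]
      show (6 : ℝ) / (1 - x 0 * x 1) = _
      simp only [eval_zero, eval_C, zero_add, pow_one]
  have heq := hPTS 2 5 2 1 (le_refl 2) (by norm_num) (le_refl 2) (le_refl 1) r₀ r' hshape hshape' hv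
  exact hrr₀.trans heq

end Summit.KontsevichZagierPeriods.Theorems.HurwitzMicroSectorsHurwitzSectorComplement

end
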